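import Mathlib
import Summits.KontsevichZagierPeriods.Zeta5Search.DoubleDropBonusProof
import Summits.KontsevichZagierPeriods.Zeta5Search.VCarrierAggregate
import Summits.KontsevichZagierPeriods.Zeta5Search.ClassTypeGuards
import HarnessLib

/-!
# ζ(5) search — the DOUBLE DROP AT DEPTH TWO: `v_p(Cas_j(b)) ≥ −1`, and `≥ 0` for `p ≤ d`, when the only non-tame classes of exponent `≤ −2` are centre-free palindromic classes at `−2` (DENOM-LAW D1, prover-d1 gen 23)

Cell `pub-zeta5` (HONEST FRAMING: systematic search; no irrationality claim unless certified), TRACK «DENOM-LAW» D1 prover seat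
(denom-prover-d1 gen 23, `HOME/denom-law/prover-d1/ATTEMPT-23.md`).  gen-2 g9's DOUBLE-DROP machinery (`DoubleDropBonusProof`:
`padicNorm_coeffV_le_dd`, the transport lemmas `ddHyp_self` / `ddHyp_shift`) is stated for an EVEN depth `N ≥ 3`; its `V`-half needs only
`N ≥ 1`: every pole class with `E_x ≤ −N` is a tame single (`ν_x ≥ 0`) or a centre-free palindromic class at exactly `−N`, whose constant
terms cancel in conjugate PAIRS (`padicNorm_classV_pair_le`, `N` even) — so `‖V(b)‖_p ≤ p^{N−1}`, and the same for `b + e_j` by transport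
(a class hit by the shift rises above `−N` and leaves the hypothesis' domain; an unhit deep class keeps its palindromic exponent vector).
At `N = 2` this is the census's «V-GAIN» rung (classifier `VG`, even kind) in cover form: `‖V(b)‖, ‖V(b + e_j)‖ ≤ p` (`padicNorm_coeffV_le_ddTwo`,
the `N ≥ 1` copy of the landed proof), and THEOREM LB's row assembly with the constant terms as input (`VCarrier.cas_val_ge_of_coeffV`,
rows `≤ 1` resp. `≤ 3 + E_x ≤ 1`, `≤ 0` at `d < p`) gives **`v_p(Cas_j(b)) ≥ −1 + [p ≤ d]`** (`doubleDropTwo`).  Cover form `doubleDropTwo_of_cover`: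
the hypotheses are gen 10's `checkB` at `N = 2` on the type list.  Consumers: the last two a = 7 profiles 4b (long blocks `(4,7),(5,6),(5,7),(6,7)`)
and 3a (long `(5,6),(5,7),(6,7)`), `DenomLaw/Profile4b3aPath` — where the deepest class is a centre-free `[1,−2,−2,1]` and THEOREM LB stops one
short of the node.  `p`-adic valuations of the cell's own rationals; nothing about ζ(5); no γ; records in print UNMOVED.
-/

noncomputable section

open Finset

namespace Summit.KontsevichZagierPeriods.Zeta5Search.DenomLaw

open Summit.KontsevichZagierPeriods.Zeta5Search.ClusterValuation
open Summit.KontsevichZagierPeriods.Zeta5Search.WedgeDictionary (coeffV dOf)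
open Summit.KontsevichZagierPeriods.Zeta5Search.CasoratianValuation (InPolytope shift casoratian)
open Summit.KontsevichZagierPeriods.Zeta5Search.BigPrime (shift_zero)
open Summit.KontsevichZagierPeriods.Zeta5Search.PadicSeries
open Summit.KontsevichZagierPeriods.Zeta5Search.ClassTypeCover

variable {p : ℕ} [hp : Fact p.Prime]

/-- **`‖V(b)‖ ≤ p^{−(1−N)}`** for EVEN `N ≥ 1` when every pole class with `E_x ≤ −N` has `ν_x ≥ 0` or is a centre-free palindromic class at
exactly `−N` (gen-2 g9's `padicNorm_coeffV_le_dd` with `1 ≤ N` in place of `3 ≤ N`; proof verbatim: the palindromic classes in conjugate pairs by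
`padicNorm_classV_pair_le`, the others termwise by `padicNorm_classV_le`). -/
theorem padicNorm_coeffV_le_ddTwo (b : ℕ → ℤ) (hb : InPolytope b) (hp5 : 5 ≤ p) (hpn : p ≤ (b 0).toNat)
    (hwin : (b 0 + 2 : ℤ) < (p : ℤ) ^ 2) {N : ℕ} (hN : 1 ≤ N) (hNe : Even N)
    (hH : ∀ x, x < p → 1 ≤ classPoleCount b p x → classExp b p x ≤ -(N : ℤ) →
      0 ≤ classNu b p x ∨ (classExp b p x = -(N : ℤ) ∧ ¬ CentreIn b p x ∧
        ∀ s ∈ classSet b p x, netExp b s = netExp b ((b 0).toNat - ((b 0).toNat - x) % p - (s - x)))) :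
    padicNorm p (coeffV b) ≤ (p : ℚ) ^ (-(1 - (N : ℤ))) := by
  classical
  have hprime := hp.out
  have hp0 : 0 < p := hprime.pos
  have h0 : 0 ≤ b 0 := hb.1.1
  set A := (range p).filter (fun x => 1 ≤ classPoleCount b p x ∧ classExp b p x = -(N : ℤ) ∧ ¬ CentreIn b p x ∧
    ∀ s ∈ classSet b p x, netExp b s = netExp b ((b 0).toNat - ((b 0).toNat - x) % p - (s - x))) with hA
  have hsingle : ∀ x, x < p → x ∉ A → padicNorm p (classV b p x) ≤ (p : ℚ) ^ (-(1 - (N : ℤ))) := by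
    intro x hx hxA
    rcases Nat.eq_zero_or_pos (classPoleCount b p x) with hc0 | hpos
    · rw [classV_eq_zero_of_noPole b hb hc0, padicNorm.zero]; exact zpow_p_nonneg _
    have hnu := CellA.classExp_le_classNu b p x
    refine (padicNorm_classV_le b hb hp5 hwin hx hpos).trans (zpow_le_zpow_right₀ one_le_p ?_)
    by_cases hE : classExp b p x ≤ -(N : ℤ)
    · rcases hH x hx hpos hE with hnu0 | hdp
      · omega
      · exact absurd (mem_filter.2 ⟨mem_range.2 hx, hpos, hdp⟩) hxA
    · omega
  rw [coeffV_eq_sum_classV b hp0, ← sum_filter_add_sum_filter_not (range p) (fun x =>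
    1 ≤ classPoleCount b p x ∧ classExp b p x = -(N : ℤ) ∧ ¬ CentreIn b p x ∧
    ∀ s ∈ classSet b p x, netExp b s = netExp b ((b 0).toNat - ((b 0).toNat - x) % p - (s - x)))]
  refine (padicNorm.nonarchimedean (p := p)).trans (max_le ?_ ?_)
  · have hmem : ∀ x ∈ A, x < p ∧ 1 ≤ classPoleCount b p x ∧ classExp b p x = -(N : ℤ) ∧ ¬ CentreIn b p x ∧
        ∀ s ∈ classSet b p x, netExp b s = netExp b ((b 0).toNat - ((b 0).toNat - x) % p - (s - x)) :=
      fun x hx => by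
        obtain ⟨hxr, h⟩ := mem_filter.1 hx
        exact ⟨mem_range.1 hxr, h⟩
    have hmapsA : ∀ x ∈ A, conjClass b p x ∈ A := by
      intro x hx
      obtain ⟨hx', hc, hE, hcx, hpal⟩ := hmem x hx
      refine mem_filter.2 ⟨mem_range.2 (conjClass_lt b hp0 x), ?_, ?_, ?_, pal_conj b h0 hp0 hx' hpn hpal⟩
      · rwa [classPoleCount_conj b h0 (by omega)]
      · rwa [classExp_conj b h0 (by omega)]
      · rwa [centreIn_conj_iff b h0 (by omega)]
    have hinv : ∀ x ∈ A, conjClass b p (conjClass b p x) = x := fun x hx =>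
      conjClass_conjClass b (hmem x hx).1 hpn
    have hpair : ∑ x ∈ A, classV b p (conjClass b p x) = ∑ x ∈ A, classV b p x :=
      sum_nbij' (conjClass b p) (conjClass b p) hmapsA hmapsA hinv hinv (fun _ _ => rfl)
    have h2 : (2 : ℚ) * ∑ x ∈ A, classV b p x = ∑ x ∈ A, (classV b p x + classV b p (conjClass b p x)) := by
      rw [sum_add_distrib, hpair, two_mul]
    have hn2 : padicNorm p (2 : ℚ) = 1 := by
      have := (padicNorm.nat_eq_one_iff (p := p) 2).2 (by
        intro h; have := (Nat.prime_dvd_prime_iff_eq hprime Nat.prime_two).1 h; omega)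
      exact_mod_cast this
    calc padicNorm p (∑ x ∈ A, classV b p x)
        = padicNorm p ((2 : ℚ) * ∑ x ∈ A, classV b p x) := by rw [padicNorm.mul, hn2, one_mul]
      _ = padicNorm p (∑ x ∈ A, (classV b p x + classV b p (conjClass b p x))) := by rw [h2]
      _ ≤ (p : ℚ) ^ (-(1 - (N : ℤ))) := by
        refine padicNorm.sum_le' (fun x hx => ?_) (zpow_p_nonneg _)
        obtain ⟨hx', hc, hE, hcx, hpal⟩ := hmem x hx
        have heven : Even (classExp b p x) := by
          obtain ⟨k, hk⟩ := hNe
          exact ⟨-(k : ℤ), by rw [hE, hk]; push_cast; ring⟩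
        have h := padicNorm_classV_pair_le b hb hp5 hpn hwin hx' hc hcx hpal heven
        rwa [hE, show -(-(N : ℤ) + 1) = -(1 - (N : ℤ)) by ring] at h
  · refine padicNorm.sum_le' (fun x hx => ?_) (zpow_p_nonneg _)
    obtain ⟨hxr, hnot⟩ := mem_filter.1 hx
    exact hsingle x (mem_range.1 hxr) (fun h => hnot (mem_filter.1 h).2)

/-- **The double drop at depth two, any depth `d`, any direction `j`**: if every class of exponent `< −2` is a tame single and every class at
`−2` is a tame single or a centre-free palindromic class, then `v_p(Cas_j(b)) ≥ 0` for `p ≤ d(b)` and `v_p(Cas_j(b)) ≥ −1` always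
(`‖V(b)‖, ‖V(b+e_j)‖ ≤ p` by `padicNorm_coeffV_le_ddTwo` and gen-2 g9's transport; rows `≤ 1` / `≤ 3 + E_x ≤ 1`, `≤ 0` at `d < p`, by
gen 12's `VCarrier.cas_val_ge_of_coeffV`). -/
theorem doubleDropTwo (b : ℕ → ℤ) (j : ℕ) (hb : InPolytope b) (hb' : InPolytope (shift b j)) (hj1 : 1 ≤ j) (hj7 : j ≤ 7)
    (hp5 : 5 ≤ p) (hpb : (p : ℤ) ≤ b 0) (hwin : (b 0 + 2 : ℤ) < (p : ℤ) ^ 2)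
    (hT : ∀ x, x < p → classExp b p x < -((2 : ℕ) : ℤ) → classPoleCount b p x = 1 ∧ tameSingle b p x = true)
    (hD : ∀ x ∈ deepClasses b p 2, (classPoleCount b p x = 1 ∧ tameSingle b p x = true) ∨
      (¬ CentreIn b p x ∧ (∀ s ∈ classSet b p x, netExp b s = netExp b ((b 0).toNat - ((b 0).toNat - x) % p - (s - x)))))
    (hcas : casoratian b j ≠ 0) :
    -1 + (if (p : ℤ) ≤ dOf b then (1 : ℤ) else 0) ≤ padicValRat p (casoratian b j) := by
  have hp0 : 0 < p := hp.out.pos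
  have h0 : 0 ≤ b 0 := hb.1.1
  have hpn : p ≤ (b 0).toNat := by
    have : (((b 0).toNat : ℕ) : ℤ) = b 0 := Int.toNat_of_nonneg h0
    omega
  have hwin' : (shift b j 0 + 2 : ℤ) < (p : ℤ) ^ 2 := by rwa [shift_zero b hj1]
  have hpn' : p ≤ (shift b j 0).toNat := by rwa [shift_zero b hj1]
  have hHb := ddHyp_self b hT hD
  have hHb' := ddHyp_shift b hb hj1 hp0 hT hD
  have hV := padicNorm_coeffV_le_ddTwo b hb hp5 hpn hwin (N := 2) (by norm_num) ⟨1, rfl⟩ hHb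
  have hV' := padicNorm_coeffV_le_ddTwo (shift b j) hb' hp5 hpn' hwin' (N := 2) (by norm_num) ⟨1, rfl⟩ hHb'
  have e : (-(1 - ((2 : ℕ) : ℤ)) : ℤ) = -(-1 : ℤ) := by norm_num
  rw [e] at hV hV'
  refine VCarrier.cas_val_ge_of_coeffV b hb hj1 hj7 hb' hp5 hwin (-1) _ hV hV' (by split_ifs <;> norm_num) ?_ ?_ hcas
  · intro x hx h2
    have hE : -((2 : ℕ) : ℤ) ≤ classExp b p x := by
      by_contra hlt
      push Not at hlt
      have := (hT x hx hlt).1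
      omega
    push_cast at hE
    split_ifs <;> linarith
  · intro hd
    rw [if_neg (by push Not; exact hd)]

/-- **The double drop at depth two from a cover**: the hypotheses read off gen 10's `checkB` at `N = 2` on the cover's type list. -/
theorem doubleDropTwo_of_cover {b : ℕ → ℤ} {j : ℕ} (hb : InPolytope b) (hj1 : 1 ≤ j) (hj7 : j ≤ 7)
    (hb' : InPolytope (shift b j)) (hp5 : 5 ≤ p) (hpb : (p : ℤ) ≤ b 0)
    (hwin : (b 0 + 2 : ℤ) < (p : ℤ) ^ 2) {TY : List (List ℤ × Bool)} (hcov : Cover b p TY)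
    (hchk : checkB (decide (¬ (2 : ℤ) ∣ b 0)) TY 2 = true) (hcas : casoratian b j ≠ 0) :
    -1 + (if (p : ℤ) ≤ dOf b then (1 : ℤ) else 0) ≤ padicValRat p (casoratian b j) := by
  rw [checkB, List.all_eq_true] at hchk
  refine doubleDropTwo b j hb hb' hj1 hj7 hp5 hpb hwin ?_ ?_ hcas
  · intro x hx hE
    obtain ⟨tc, htc, ht⟩ := hcov x hx
    have hc0 := hchk tc htc
    simp only [Bool.or_eq_true, Bool.not_eq_true', decide_eq_false_iff_not, Bool.and_eq_true,
      decide_eq_true_eq] at hc0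
    have hc := hc0.1
    rw [ht.classExp_eq] at hE
    rw [ht.classPoleCount_eq, ht.tameSingle_eq]
    rcases hc with h | h
    · exact absurd hE h
    · exact h
  · intro x hxd
    obtain ⟨hx, hE⟩ := (mem_deepClasses_iff b p 2 x).1 hxd
    obtain ⟨tc, htc, ht⟩ := hcov x hx
    have hc0 := hchk tc htc
    simp only [Bool.or_eq_true, Bool.not_eq_true', decide_eq_false_iff_not, Bool.and_eq_true,
      decide_eq_true_eq] at hc0
    have hc := hc0.2
    rw [ht.classExp_eq] at hE
    rcases hc with h | h | ⟨hc1, hc2⟩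
    · exact absurd hE h
    · left; rw [ht.classPoleCount_eq, ht.tameSingle_eq]; exact h
    · right
      refine ⟨fun hcen => ?_, ht.pal_classSet hc2⟩
      have := ht.cen_iff.1 hcen
      rw [this] at hc1
      exact Bool.noConfusion hc1

/-- **Cover form with the prime as an explicit hypothesis** (the shape used by the profile files): `c ≤ v_p(Cas_j(b))` for any
`c ≤ −1 + [p ≤ d]`. -/
theorem cover_DD2_j {b : ℕ → ℤ} {j : ℕ} (hb : InPolytope b) (hj1 : 1 ≤ j) (hj7 : j ≤ 7) (hb' : InPolytope (shift b j))
    (hp5 : 5 ≤ p) (hpb : (p : ℤ) ≤ b 0) (hwin : (b 0 + 2 : ℤ) < (p : ℤ) ^ 2)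
    {TY : List (List ℤ × Bool)} (hcov : Cover b p TY) (hchk : checkB (decide (¬ (2 : ℤ) ∣ b 0)) TY 2 = true) {c : ℤ}
    (hc : c ≤ -1 + (if (p : ℤ) ≤ dOf b then (1 : ℤ) else 0)) (hcas : casoratian b j ≠ 0) :
    c ≤ padicValRat p (casoratian b j) :=
  le_trans (by exact_mod_cast hc) (doubleDropTwo_of_cover hb hj1 hj7 hb' hp5 hpb hwin hcov hchk hcas)

end Summit.KontsevichZagierPeriods.Zeta5Search.DenomLaw

end
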